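/-
Copyright (c) 2026 the pub-hodgecm-mathlib formalisation cell (harness21).  Prover seat hodgecm-mathlib-LH4-p12 (g5), Track A «(D-RAM) FOUR-FRAME», unit U2H, the (ρ2b′-X)
census road — S2′-R «THE RAMIFIED THIRD-FIELD PACKAGE», part 2: the EVEN-ORDER clause derived from `Θ ≠ id`, and the corollary head over a uniformiser.  2026-09-04.
-/
import Literature.NumberTheory.LocalFields.ValuedFixedFieldRamified   -- ★ p857876 (this seat): `exists_valuedFixedField_ramified` and the ℤᵐ⁰ halving lemmas
import HarnessLib

/-!
# The ramified third field, part 2: a residually trivial isometric involution that fixes a uniformiser is the identity; hence `Θ ≠ id` forces EVEN order on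
# `Fix Θ`, and the package ★ `exists_valuedFixedField_ramified` holds from `Θ ≠ id` and ANY uniformiser `ϖM` of `K` (`π' = ϖM·ΘϖM`)

Topic `NumberTheory/LocalFields`; namespace `Literature.NumberTheory.LocalFields.ValuedFixedFieldRamified` (continued).  THEOREMS ONLY (no definition, no instance, no
notation, no named fact, no `sorry`); helper lane `--supports stmt-HodgeConjecture-24833` (cell `pub/hodgecm-mathlib`, crux H413, seam S2′-R of the (ρ2b′-X) census: this
removes the inputs `hev`, `P`, `hΘP`, `hP` of ★ part 1 from the consumers' burden — at the RamK rows of ★ `F0P3cDyRamToricLevelCensusRamKHyper` the even-order clause is not a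
datum clause and must be derived; here it is).

THE MATHEMATICS (Serre, *Local Fields*, Ch. I §4; elementary, no completeness needed for §3's first three results).  `Θ` an isometric involution of a `ℤᵐ⁰`-valued field `K`
with finite residue field, RESIDUALLY TRIVIAL (`|x − Θx| < 1` on integers).
* `exists_fixed_near` — RESIDUE SURJECTIVITY of `Fix Θ` (standalone): every integer is within `< 1` of a Θ-fixed integer (`(z + Θz)∕2`, or `w·Θw` with `w̄² = z̄` in residue
  characteristic `2`, Frobenius being onto the finite residue field).
* `map_eq_self_of_fixed_uniformizer` — if some Θ-FIXED `y` has `|y| = exp(−1)` then `Θ = id`: every integer is `m = x₀ + y·m₁` with `x₀` fixed, so `Θm − m = y·(Θm₁ − m₁)` and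
  by induction `|Θm − m| ≤ exp(−n)` for all `n`.
* `even_order_of_fixed` — consequently, if `Θ ≠ id` and a Θ-fixed `P` has `|P| = exp(−2)`, every Θ-fixed `z ≠ 0` has EVEN order (else `z·P^j` is a fixed uniformiser).
* `exists_valuedFixedField_ramified_of_ne` — ★ part 1's package with `(hev) (hΘP) (hP)` replaced by `(hΘne : ∃ x, Θ x ≠ x)` and a uniformiser `ϖM` (`|ϖM| = exp(−1)`),
  `jK π' = ϖM * Θ ϖM`.
HONEST LABEL: count-neutral local algebra; closes no socket by itself; HC_CM is proved only modulo the 7 printed citations (2 remaining named inputs: hLiu418 =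
stmt-HodgeConjecture-24832, h413 = stmt-HodgeConjecture-24833) until rung 0 closes; (ρ2b′-X) is an OPEN prover target.

## References
* [Serre1979] J.-P. Serre, *Local Fields*, GTM 67 (1979), Ch. I §1 Prop. 1, Ch. I §4 Prop. 10 (totally ramified ⇔ equal residue fields; `ef = n`), Ch. II §1.
* [NeukirchANT1999] J. Neukirch, *Algebraic Number Theory*, Grundlehren 322 (1999), Ch. II (4.8)–(4.9).
-/

set_option autoImplicit false

open WithZero IsLocalRing Filter Set
open scoped Valued Topology Uniformity

namespace Literature.NumberTheory.LocalFields.ValuedFixedFieldRamified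

/-- `|2| ≤ 1` in any valued field. [cite: Serre1979, Ch. II §1] -/
private theorem v_two_le_one {K : Type*} [Field K] [Valued K ℤᵐ⁰] : Valued.v (2 : K) ≤ 1 := by
  have h : (2 : K) = 1 + 1 := by norm_num
  rw [h]
  exact (Valuation.map_add _ _ _).trans (by rw [Valuation.map_one, max_self])

/-! ## §3 Deriving the EVEN-ORDER clause: a residually trivial involution fixing a uniformiser is the identity -/

/-- **RESIDUE SURJECTIVITY of `Fix Θ`** (standalone form of the step inside the head): if `Θ` is an isometric involution, residually trivial (`|z − Θz| < 1` on integers),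
and the residue field is finite, every integer `z` is within distance `< 1` of a Θ-FIXED integer — `(z + Θz)∕2` if `|2| = 1`, `w·Θw` with `w̄² = z̄` if `|2| < 1` (Frobenius is onto).
[cite: Serre1979, Ch. I §4 Prop. 10] -/
theorem exists_fixed_near {K : Type*} [Field K] [Valued K ℤᵐ⁰] [Finite 𝓀[K]] {Θ : K →+* K} (hΘΘ : ∀ x, Θ (Θ x) = x)
    (hvΘ : ∀ x, Valued.v (Θ x) = Valued.v x) (hΘres : ∀ x : K, Valued.v x ≤ 1 → Valued.v (x - Θ x) < 1) (z : K) (hz : Valued.v z ≤ 1) :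
    ∃ x : K, Θ x = x ∧ Valued.v x ≤ 1 ∧ Valued.v (z - x) < 1 := by
  rcases (v_two_le_one (K := K)).lt_or_eq with h2 | h2
  · have h2m : (⟨2, v_two_le_one⟩ : 𝒪[K]) ∈ 𝓂[K] := by
      rw [Valued.maximalIdeal, IsLocalRing.mem_maximalIdeal, mem_nonunits_iff, Valuation.Integer.not_isUnit_iff_valuation_lt_one]
      exact h2
    have h20 : (2 : 𝓀[K]) = 0 := by
      have h : IsLocalRing.residue 𝒪[K] ⟨2, v_two_le_one⟩ = 0 := (IsLocalRing.residue_eq_zero_iff _).2 h2m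
      rwa [show (⟨2, v_two_le_one⟩ : 𝒪[K]) = 2 from rfl, map_ofNat] at h
    haveI : CharP 𝓀[K] 2 := (CharP.charP_iff_prime_eq_zero Nat.prime_two).2 h20
    have hsurj : Function.Surjective (frobenius 𝓀[K] 2) := Finite.surjective_of_injective (frobenius 𝓀[K] 2).injective
    obtain ⟨wbar, hw⟩ := hsurj (IsLocalRing.residue 𝒪[K] ⟨z, hz⟩)
    obtain ⟨w, rfl⟩ := IsLocalRing.residue_surjective wbar
    have hzw : Valued.v (z - (w : K) ^ 2) < 1 := by
      have h : IsLocalRing.residue 𝒪[K] (⟨z, hz⟩ - w ^ 2) = 0 := by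
        rw [map_sub, map_pow, sub_eq_zero, ← hw, frobenius_def]
      rw [IsLocalRing.residue_eq_zero_iff, IsLocalRing.mem_maximalIdeal, mem_nonunits_iff,
        Valuation.Integer.not_isUnit_iff_valuation_lt_one] at h
      exact h
    refine ⟨(w : K) * Θ (w : K), by rw [map_mul, hΘΘ, mul_comm], ?_, ?_⟩
    · rw [map_mul, hvΘ]; exact mul_le_one' w.2 w.2
    · have hsplit : z - (w : K) * Θ (w : K) = (z - (w : K) ^ 2) + (w : K) * ((w : K) - Θ (w : K)) := by ring
      rw [hsplit]
      refine Valuation.map_add_lt _ hzw ?_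
      rw [map_mul]
      exact mul_lt_one_of_nonneg_of_lt_one_right (w.2) zero_le (hΘres _ w.2)
  · have h20 : (2 : K) ≠ 0 := fun h => by rw [h, map_zero] at h2; exact zero_ne_one h2
    refine ⟨(z + Θ z) / 2, by rw [map_div₀, map_add, hΘΘ, map_ofNat, add_comm], ?_, ?_⟩
    · rw [map_div₀, h2, div_one]
      exact (Valuation.map_add _ _ _).trans (max_le hz (by rw [hvΘ]; exact hz))
    · have hsplit : z - (z + Θ z) / 2 = (z - Θ z) / 2 := by field_simp; ring
      rw [hsplit, map_div₀, h2, div_one]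
      exact hΘres z hz

/-- In `ℤᵐ⁰`: `γ < exp m ⇒ γ ≤ exp (m − 1)` (discreteness). [cite: Serre1979, Ch. I §1 Prop. 1] -/
theorem le_exp_sub_one_of_lt {γ : ℤᵐ⁰} {m : ℤ} (h : γ < exp m) : γ ≤ exp (m - 1) := by
  rcases eq_or_ne γ 0 with rfl | hγ
  · exact zero_le
  · obtain ⟨k, rfl⟩ : ∃ k : ℤ, γ = exp k := ⟨_, (exp_log hγ).symm⟩
    rw [exp_lt_exp] at h; rw [exp_le_exp]; omega

/-- **A RESIDUALLY TRIVIAL ISOMETRIC INVOLUTION FIXING A UNIFORMISER IS THE IDENTITY** (finite residue field): with a Θ-fixed `y`, `|y| = exp(−1)`, every integer is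
`m = x₀ + y·m₁` with `x₀` Θ-fixed (residue surjectivity), so `Θm − m = y·(Θm₁ − m₁)` and by induction `|Θm − m| ≤ exp(−n)` for all `n` — hence `Θ = id`.  (So when `Θ ≠ id`,
`Fix Θ` contains no uniformiser: `K ∕ Fix Θ` is RAMIFIED.) [cite: Serre1979, Ch. I §4 Prop. 10] -/
theorem map_eq_self_of_fixed_uniformizer {K : Type*} [Field K] [Valued K ℤᵐ⁰] [Finite 𝓀[K]] {Θ : K →+* K} (hΘΘ : ∀ x, Θ (Θ x) = x)
    (hvΘ : ∀ x, Valued.v (Θ x) = Valued.v x) (hΘres : ∀ x : K, Valued.v x ≤ 1 → Valued.v (x - Θ x) < 1)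
    {y : K} (hΘy : Θ y = y) (hy : Valued.v y = exp (-1 : ℤ)) (x : K) : Θ x = x := by
  have hy0 : y ≠ 0 := fun h => by rw [h, map_zero] at hy; exact exp_ne_zero hy.symm
  -- `|Θm − m| ≤ exp(−n)` for every integer `m`, by induction on `n`
  have hind : ∀ n : ℕ, ∀ m : K, Valued.v m ≤ 1 → Valued.v (Θ m - m) ≤ exp (-(n : ℤ)) := by
    intro n
    induction n with
    | zero =>
      intro m hm
      exact (Valuation.map_sub _ _ _).trans (max_le (by rw [hvΘ]; exact hm) hm)
    | succ n ih =>
      intro m hm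
      obtain ⟨x₀, hx₀, -, hmx⟩ := exists_fixed_near hΘΘ hvΘ hΘres m hm
      have hmx' : Valued.v (m - x₀) ≤ Valued.v y := by
        have h := le_exp_sub_one_of_lt (m := 0) (by rw [exp_zero]; exact hmx)
        rwa [zero_sub, ← hy] at h
      set m₁ : K := (m - x₀) / y with hm₁
      have hm₁1 : Valued.v m₁ ≤ 1 := by
        rw [hm₁, map_div₀]; exact div_le_one_of_le₀ hmx' zero_le
      have hdec : Θ m - m = y * (Θ m₁ - m₁) := by
        have h : m = x₀ + y * m₁ := by rw [hm₁]; field_simp; ring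
        conv_lhs => rw [h]
        rw [map_add, map_mul, hx₀, hΘy]; ring
      rw [hdec, map_mul, hy]
      have hstep : exp (-1 : ℤ) * Valued.v (Θ m₁ - m₁) ≤ exp (-1 : ℤ) * exp (-(n : ℤ)) :=
        mul_le_mul_right (ih m₁ hm₁1) (exp (-1 : ℤ))
      refine hstep.trans (le_of_eq ?_)
      rw [← exp_add]; congr 1; push_cast; ring
  have hint : ∀ m : K, Valued.v m ≤ 1 → Θ m = m := by
    intro m hm
    by_contra hne
    have h0 : Valued.v (Θ m - m) ≠ 0 := (Valuation.ne_zero_iff _).2 (sub_ne_zero.2 hne)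
    obtain ⟨k, hk⟩ : ∃ k : ℤ, Valued.v (Θ m - m) = exp k := ⟨_, (exp_log h0).symm⟩
    have h := hind (k.natAbs + 1) m hm
    rw [hk, exp_le_exp] at h
    omega
  rcases le_or_gt (Valued.v x) 1 with hx | hx
  · exact hint x hx
  · have hx0 : x ≠ 0 := fun h => by rw [h, map_zero] at hx; exact not_lt_zero hx
    have hinv : Valued.v x⁻¹ ≤ 1 := by rw [map_inv₀]; exact inv_le_one_of_one_le₀ hx.le
    have h := hint x⁻¹ hinv
    rw [map_inv₀, inv_inj] at h
    exact h

/-- **THE EVEN-ORDER CLAUSE, DERIVED**: for a residually trivial isometric involution `Θ ≠ id` (finite residue field) and a Θ-fixed `P` with `|P| = exp(−2)`, every Θ-fixed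
`z ≠ 0` has EVEN order — otherwise `z·P^j` is a Θ-fixed uniformiser and `Θ = id` (★ `map_eq_self_of_fixed_uniformizer`). [cite: Serre1979, Ch. I §4 Prop. 10] -/
theorem even_order_of_fixed {K : Type*} [Field K] [Valued K ℤᵐ⁰] [Finite 𝓀[K]] {Θ : K →+* K} (hΘΘ : ∀ x, Θ (Θ x) = x)
    (hvΘ : ∀ x, Valued.v (Θ x) = Valued.v x) (hΘres : ∀ x : K, Valued.v x ≤ 1 → Valued.v (x - Θ x) < 1) (hΘne : ∃ x, Θ x ≠ x)
    {P : K} (hΘP : Θ P = P) (hP : Valued.v P = exp (-2 : ℤ)) (z : K) (hΘz : Θ z = z) (hz : z ≠ 0) :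
    ∃ n : ℤ, Valued.v z = exp (2 * n) := by
  have hP0 : P ≠ 0 := fun h => by rw [h, map_zero] at hP; exact exp_ne_zero hP.symm
  obtain ⟨k, hk⟩ : ∃ k : ℤ, Valued.v z = exp k := ⟨_, (exp_log ((Valuation.ne_zero_iff _).2 hz)).symm⟩
  rcases Int.even_or_odd k with ⟨n, hn⟩ | ⟨n, hn⟩
  · exact ⟨n, by rw [hk, hn, two_mul]⟩
  · exfalso
    obtain ⟨x, hx⟩ := hΘne
    -- `y := z · P^(n+1)` is a Θ-fixed uniformiser
    have hy : Valued.v (z * P ^ (n + 1)) = exp (-1 : ℤ) := by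
      rw [map_mul, map_zpow₀, hk, hP, ← exp_zsmul, zsmul_eq_mul, ← exp_add, hn]
      congr 1; push_cast; ring
    have hΘy : Θ (z * P ^ (n + 1)) = z * P ^ (n + 1) := by rw [map_mul, map_zpow₀, hΘz, hΘP]
    exact hx (map_eq_self_of_fixed_uniformizer hΘΘ hvΘ hΘres hΘy hy x)

/-- **THE RAMIFIED THIRD-FIELD PACKAGE FROM `Θ ≠ id` AND A UNIFORMISER** (corollary head): same conclusion as ★ `exists_valuedFixedField_ramified`, with the inputs
`(hev) (hΘP) (hP)` REPLACED by `Θ ≠ id` and any uniformiser `ϖM` of `K` (`|ϖM| = exp(−1)`); the package's `π'` is then `ϖM·ΘϖM` (`jK π' = ϖM * Θ ϖM`).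
[cite: Serre1979, Ch. I §4 Prop. 10; Ch. II §1] [cite: NeukirchANT1999, Ch. II (4.8)–(4.9)] -/
theorem exists_valuedFixedField_ramified_of_ne {K : Type} [Field K] [Valued K ℤᵐ⁰] [CompleteSpace K] [Finite 𝓀[K]]
    {Θ ρ : K →+* K} (hΘΘ : ∀ x, Θ (Θ x) = x) (hvΘ : ∀ x, Valued.v (Θ x) = Valued.v x)
    (hΘres : ∀ x : K, Valued.v x ≤ 1 → Valued.v (x - Θ x) < 1) (hΘne : ∃ x, Θ x ≠ x)
    (hρρ : ∀ x, ρ (ρ x) = x) (hvρ : ∀ x, Valued.v (ρ x) = Valued.v x) (hΘρ : ∀ x, Θ (ρ x) = ρ (Θ x))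
    {ϖM : K} (hϖM : Valued.v ϖM = exp (-1 : ℤ)) :
    ∃ (K' : Type) (_ : Field K') (_ : Valued K' ℤᵐ⁰) (σ' : K' →+* K') (π' : K') (jK : K' →+* K),
      IsDiscreteValuationRing 𝒪[K'] ∧ Finite 𝓀[K'] ∧ Nat.card 𝓀[K'] = Nat.card 𝓀[K] ∧ CompleteSpace K' ∧
      (∀ x, σ' (σ' x) = x) ∧ (∀ x, Valued.v (σ' x) = Valued.v x) ∧
      (∀ x, Valued.v (jK x) = Valued.v x ^ 2) ∧ (∀ x y : K', Valued.v (jK x) ≤ Valued.v (jK y) ↔ Valued.v x ≤ Valued.v y) ∧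
      (∀ x, Θ (jK x) = jK x) ∧ (∀ z : K, Θ z = z → ∃ x, jK x = z) ∧ (∀ x, jK (σ' x) = ρ (jK x)) ∧
      Valued.v π' = exp (-1 : ℤ) ∧ jK π' = ϖM * Θ ϖM ∧
      (∀ z : K, Valued.v z ≤ 1 → ∃ x : K', Valued.v x ≤ 1 ∧ Valued.v (z - jK x) < 1) := by
  have hΘP : Θ (ϖM * Θ ϖM) = ϖM * Θ ϖM := by rw [map_mul, hΘΘ, mul_comm]
  have hP : Valued.v (ϖM * Θ ϖM) = exp (-2 : ℤ) := by
    rw [map_mul, hvΘ, hϖM, ← exp_add]; rfl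
  exact exists_valuedFixedField_ramified hΘΘ hvΘ hΘres (even_order_of_fixed hΘΘ hvΘ hΘres hΘne hΘP hP) hρρ hvρ hΘρ hΘP hP

end Literature.NumberTheory.LocalFields.ValuedFixedFieldRamified
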